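import Summits.NavierStokesRegularity.NavierStokesRegularity.Theorems.HeredityAtOneT.Negative.HeredityAtOneTFalseOfSubfloorStageAtOneT
import Summits.NavierStokesRegularity.FluidComputer.PalasekTowerFaceLayerAtEnvelope

/-!
# The sub-floor template against the FIVE-FACE cut: a sub-floor stage kills the WINDOW CEILING or the SPEED FLOOR
# (`¬ WindowCeilingGAt R k ∨ ¬ SpeedFloorGAt R k`), and the tame-miss templates against the three floor faces

Cell `ns-blowup`, seat `ns-blowup-refuter4` (g9, K203; refuter of record for route `PalasekTowerBreakdown` rev 19, RE-BASE
cruxes `HeredityAtOneT` = stmt-…-20304 and `HeredityFromTwoT` = stmt-…-20305). Negative lemmas only (`Theorems/<Crux>/Negative/`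
lane): no definition, no Theses statement asserted, nothing about Navier–Stokes decided.

The planner's BIRTH skeletons **v2** (STATUS 2026-08-27T11:51Z) cut the two heredity cruxes into the tree's FIVE R-generic faces
(`PalasekTowerFaceLayerAt{,Envelope}.lean`, fc-prover-2): `HeredityAtOneT ↔ NoPrematureBreakdownGAt tuned 1 ∧ WindowCeilingGAt
tuned 1 ∧ SpeedFloorGAt tuned 1 ∧ StrainFloorGAt tuned 1 ∧ CoreFloorGAt tuned 1` (stubs `stub_no_premature_breakdownT1`,
`stub_window_ceilingT1`, `stub_speed_floorT1`, `stub_strain_floorT1`, `stub_core_floorT1`), and the `∀ k ≥ 2` analogue for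
`HeredityFromTwoT` (`stub_*_from2`). Against this cut the standing SUB-FLOOR witness class `SubfloorStageGAt R k` (p525716: a
pinned rigid quiet design with a registered level-`k` stage whose flow LIVES classically with finite energy to `τ (k+1)` and
MISSES the speed floor `c₁ Y_{k+1}` in the ball at `τ (k+1)`) no longer bites one named stub but EXACTLY ONE OF TWO:

* §1 (R-generic) if the window ceiling holds at `(R, k)`, the sub-floor competitor — re-gauged in pressure to the stage's
  (`Stage.exists_pressure_regauge`, a tree theorem), equal to the stage's velocity before `τ k` (forced uniqueness,
  `Stage.velocity_eq_of_classical`) hence inside `c₂ Y_k ≤ c₂ Y_{k+1}` there, and inside `c₂ Y_{k+1}` on the window by the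
  ceiling face — is an admissible readout competitor, so `SpeedFloorGAt R k` would put it ON the floor: contradiction. Hence
  `SubfloorStageGAt R k → WindowCeilingGAt R k → ¬ SpeedFloorGAt R k`, i.e. `SubfloorStageGAt R k → ¬ WindowCeilingGAt R k ∨
  ¬ SpeedFloorGAt R k`; the (C)-face and the strain/core floors are untouched by this witness.
* §2 (R-generic) the TAME-MISS templates: an admissible readout competitor (classical from the Clay datum on `[0, τ (k+1)]`,
  finite energy, inside the next ceiling on the window) missing the speed / strain / core-circulation floor at `τ (k+1)`
  refutes `SpeedFloorGAt` / `StrainFloorGAt` / `CoreFloorGAt R k` (velocity-only hypotheses; the schema's pressure clause is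
  discharged by the regauge).
* §3 the corollaries on the tuned rates by the v2 stub statements and the route's names (`SubfloorStageAtOneT →
  stub_window_ceilingT1 → ¬ stub_speed_floorT1`; a sub-floor stage at a tuned level `k ≥ 2` → `stub_window_ceiling_from2 →
  ¬ stub_speed_floor_from2`; each routed into `¬ HeredityAtOneT` / `¬ HeredityFromTwoT` through the five-face equivalence;
  the unconditional kills of the cruxes by these witnesses are p525716 / K202 and are not restated).

READING (for the planner and the 20304/20305 provers). The v2 cut moves the sub-floor exposure of record from one stub
(v1: `HeredityOrBreakdownGAt`) onto the PAIR {window ceiling, speed floor}: a sub-floor design that respects the ceiling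
kills the speed-floor stub, one that overshoots kills the ceiling stub (K202's surviving-overshoot template). Neither
floor stub is insulated by the schema's pressure-agreement clause — pressure is re-gauged for free. LABEL: refuter kernel
certificate (E–C typing). WHAT THIS IS NOT: not NS — no design, stage or competitor is constructed; no item is refuted.
References: [cite: Sohr2001, Ch. V Thm. 1.5.1] (forced uniqueness — a theorem of the tree); [cite: Seeley1964, Theorem]
(the pressure gauge extension, inside `exists_pressure_regauge`); [cite: Palasek2026ElementaryModel, §4].
-/

namespace Summit.NavierStokesRegularity.HeredityAtOneTSubfloor

open Set MeasureTheory
open scoped ENNReal NNReal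
open Literature.Analysis.FluidPDE
open Summit.NavierStokesRegularity.FluidComputer.PalasekTowerClayBridge
open Summit.NavierStokesRegularity.NavierStokesRegularity

section Generic

variable {R : TowerRates} {k : ℕ} {S : Schedule R}

/-! ## §2 The tame-miss templates (velocity-only hypotheses) -/

/-- A classical finite-energy competitor from the Clay datum on `[0, τ (k+1)]`, inside the next ceiling on the growth
window, is — after a pressure regauge — an admissible competitor of the readout schema `ReadoutGAt R k P`; so it satisfies
every readout `P` that holds at `(R, k)`. [cite: Seeley1964, Theorem] -/
theorem readoutGAt_apply_of_window_ceiling {P : Schedule R → (EuclideanSpace ℝ (Fin 3) → EuclideanSpace ℝ (Fin 3)) → Prop}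
    (hF : ReadoutGAt R k P) (hP : S.Pins 8 (6 / 5)) (hR : S.Rigid) (hQ : S.Quiet) (s : Stage 1 R S (Margins.routeG R) k)
    {u : ℝ → EuclideanSpace ℝ (Fin 3) → EuclideanSpace ℝ (Fin 3)} {p : ℝ → EuclideanSpace ℝ (Fin 3) → ℝ}
    (hcl : IsClassicalNSSolutionOn (Icc 0 (S.τ (k + 1))) 1 S.f u p) (hu0 : u 0 = S.u₀)
    (hE : ∃ C : ℝ≥0∞, C < ⊤ ∧ ∀ t ∈ Icc 0 (S.τ (k + 1)), ∫⁻ x, ‖u t x‖ₑ ^ 2 ≤ C)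
    (hceil : ∀ t ∈ Icc (S.τ k) (S.τ (k + 1)), ∀ x, ‖u t x‖ ≤ S.c₂ * R.Y (k + 1)) :
    P S (u (S.τ (k + 1))) := by
  have hτle : S.τ k ≤ S.τ (k + 1) := S.τ_mono (Nat.le_succ k)
  have hvel : ∀ t ∈ Icc 0 (S.τ k), u t = s.u t := s.velocity_eq_of_classical one_pos hτle hcl hu0 hE
  obtain ⟨q, hclq, hagree⟩ := s.exists_pressure_regauge hτle hcl hvel
  have hceil' : ∀ t ∈ Icc 0 (S.τ (k + 1)), ∀ x, ‖u t x‖ ≤ S.c₂ * R.Y (k + 1) := by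
    intro t ht x
    rcases le_or_gt t (S.τ k) with htk | htk
    · rw [hvel t ⟨ht.1, htk⟩]
      exact (s.ceiling k le_rfl t ⟨ht.1, htk⟩ x).trans (mul_le_mul_of_nonneg_left (R.Y_le_Y_succ k) s.c₂_pos.le)
    · exact hceil t ⟨htk.le, ht.2⟩ x
  exact hF S hP hR hQ s u q hclq hagree hE hceil'

/-- **Tame speed miss refutes `SpeedFloorGAt R k`.** [cite: Sohr2001, Ch. V Thm. 1.5.1] -/
theorem not_speedFloorGAt_of_tame_miss (hP : S.Pins 8 (6 / 5)) (hR : S.Rigid) (hQ : S.Quiet)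
    (s : Stage 1 R S (Margins.routeG R) k)
    {u : ℝ → EuclideanSpace ℝ (Fin 3) → EuclideanSpace ℝ (Fin 3)} {p : ℝ → EuclideanSpace ℝ (Fin 3) → ℝ}
    (hcl : IsClassicalNSSolutionOn (Icc 0 (S.τ (k + 1))) 1 S.f u p) (hu0 : u 0 = S.u₀)
    (hE : ∃ C : ℝ≥0∞, C < ⊤ ∧ ∀ t ∈ Icc 0 (S.τ (k + 1)), ∫⁻ x, ‖u t x‖ₑ ^ 2 ≤ C)
    (hceil : ∀ t ∈ Icc (S.τ k) (S.τ (k + 1)), ∀ x, ‖u t x‖ ≤ S.c₂ * R.Y (k + 1))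
    (hmiss : ∀ x, ‖x‖ ≤ S.radius → ‖u (S.τ (k + 1)) x‖ < S.c₁ * R.Y (k + 1)) :
    ¬ SpeedFloorGAt R k := by
  intro hF
  obtain ⟨x, hx, hfl⟩ := readoutGAt_apply_of_window_ceiling hF hP hR hQ s hcl hu0 hE hceil
  exact absurd hfl (not_le.2 (hmiss x hx))

/-- **Tame strain miss refutes `StrainFloorGAt R k`.** [cite: Sohr2001, Ch. V Thm. 1.5.1] -/
theorem not_strainFloorGAt_of_tame_miss (hP : S.Pins 8 (6 / 5)) (hR : S.Rigid) (hQ : S.Quiet)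
    (s : Stage 1 R S (Margins.routeG R) k)
    {u : ℝ → EuclideanSpace ℝ (Fin 3) → EuclideanSpace ℝ (Fin 3)} {p : ℝ → EuclideanSpace ℝ (Fin 3) → ℝ}
    (hcl : IsClassicalNSSolutionOn (Icc 0 (S.τ (k + 1))) 1 S.f u p) (hu0 : u 0 = S.u₀)
    (hE : ∃ C : ℝ≥0∞, C < ⊤ ∧ ∀ t ∈ Icc 0 (S.τ (k + 1)), ∫⁻ x, ‖u t x‖ₑ ^ 2 ≤ C)
    (hceil : ∀ t ∈ Icc (S.τ k) (S.τ (k + 1)), ∀ x, ‖u t x‖ ≤ S.c₂ * R.Y (k + 1))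
    (hmiss : ∀ x, ‖x‖ ≤ S.radius → ‖fderiv ℝ (u (S.τ (k + 1))) x‖ < S.c₁ * R.A (k + 1)) :
    ¬ StrainFloorGAt R k := by
  intro hF
  obtain ⟨x, hx, hfl⟩ := readoutGAt_apply_of_window_ceiling hF hP hR hQ s hcl hu0 hE hceil
  exact absurd hfl (not_le.2 (hmiss x hx))

/-- **Tame core-circulation miss refutes `CoreFloorGAt R k`.** [cite: Sohr2001, Ch. V Thm. 1.5.1] -/
theorem not_coreFloorGAt_of_tame_miss (hP : S.Pins 8 (6 / 5)) (hR : S.Rigid) (hQ : S.Quiet)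
    (s : Stage 1 R S (Margins.routeG R) k)
    {u : ℝ → EuclideanSpace ℝ (Fin 3) → EuclideanSpace ℝ (Fin 3)} {p : ℝ → EuclideanSpace ℝ (Fin 3) → ℝ}
    (hcl : IsClassicalNSSolutionOn (Icc 0 (S.τ (k + 1))) 1 S.f u p) (hu0 : u 0 = S.u₀)
    (hE : ∃ C : ℝ≥0∞, C < ⊤ ∧ ∀ t ∈ Icc 0 (S.τ (k + 1)), ∫⁻ x, ‖u t x‖ₑ ^ 2 ≤ C)
    (hceil : ∀ t ∈ Icc (S.τ k) (S.τ (k + 1)), ∀ x, ‖u t x‖ ≤ S.c₂ * R.Y (k + 1))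
    (hmiss : ∀ (x : EuclideanSpace ℝ (Fin 3)) (γ : ℝ → EuclideanSpace ℝ (Fin 3)), ‖x‖ ≤ S.radius →
      ContDiff ℝ 1 γ → γ 0 = γ 1 → (∀ σ ∈ Icc (0 : ℝ) 1, γ σ ∈ Metric.closedBall x (1 / R.N (k + 1))) →
      (∀ σ ∈ Icc (0 : ℝ) 1, ‖deriv γ σ‖ ≤ 8 * Real.pi / R.N (k + 1)) →
      circulation (u (S.τ (k + 1))) γ < S.c₁ * R.N (k + 1) ^ (R.β - 2)) :
    ¬ CoreFloorGAt R k := by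
  intro hF
  obtain ⟨x, γ, hx, hγ, hγ01, hball, hspeed, hfl⟩ := readoutGAt_apply_of_window_ceiling hF hP hR hQ s hcl hu0 hE hceil
  exact absurd hfl (not_le.2 (hmiss x γ hx hγ hγ01 hball hspeed))

end Generic

/-! ## §1 The sub-floor witness class against the pair {window ceiling, speed floor} -/

/-- **If the window ceiling holds at `(R, k)`, a sub-floor stage at level `k` refutes `SpeedFloorGAt R k`** — so a
sub-floor stage kills the window ceiling OR the speed floor (`by_cases` on `WindowCeilingGAt R k`): one that respects the
ceiling kills the speed-floor face, one that overshoots kills the ceiling face. [cite: Sohr2001, Ch. V Thm. 1.5.1] -/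
theorem not_speedFloorGAt_of_subfloorStageGAt_of_windowCeilingGAt {R : TowerRates} {k : ℕ}
    (hW : SubfloorStageGAt R k) (hC : WindowCeilingGAt R k) : ¬ SpeedFloorGAt R k := by
  obtain ⟨S, u, p, hP, hR, hQ, ⟨s⟩, hcl, hu0, hE, hsub⟩ := hW
  exact not_speedFloorGAt_of_tame_miss hP hR hQ s hcl hu0 hE (hC S hP hR hQ s u p hcl hu0 hE) hsub

/-! ## §3 On the tuned rates, by the v2 stub statements and the route's names -/

/-- **Given `stub_window_ceilingT1`, `SubfloorStageAtOneT` kills `stub_speed_floorT1`** (BIRTH-20304 v2; without the ceiling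
stub it kills one of the two). [cite: Sohr2001, Ch. V Thm. 1.5.1] -/
theorem speedFloorT1_false_of_SubfloorStageAtOneT_of_windowCeilingT1 (hW : SubfloorStageAtOneT)
    (hC : WindowCeilingGAt TowerRates.tuned 1) : ¬ SpeedFloorGAt TowerRates.tuned 1 :=
  not_speedFloorGAt_of_subfloorStageGAt_of_windowCeilingGAt hW hC

/-- The hold of record re-read through the v2 cut: given the ceiling stub, `SubfloorStageAtOneT` kills `HeredityAtOneT` VIA the
speed-floor face (the planner's `HeredityAtOneT_of` needs `stub_speed_floorT1`). [folklore] -/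
theorem HeredityAtOneT_false_of_SubfloorStageAtOneT_of_windowCeilingT1 (hW : SubfloorStageAtOneT)
    (hC : WindowCeilingGAt TowerRates.tuned 1) : ¬ Theses.PalasekTowerBreakdown.HeredityAtOneT := fun h =>
  speedFloorT1_false_of_SubfloorStageAtOneT_of_windowCeilingT1 hW hC
    ((heredityAtGAt_iff_noPrematureBreakdown_windowCeiling_floors3 1).1 h).2.2.1

/-- **Given `stub_window_ceiling_from2`, a sub-floor stage at a tuned level `k ≥ 2` kills `stub_speed_floor_from2`**
(BIRTH-20305 v2). [cite: Sohr2001, Ch. V Thm. 1.5.1] -/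
theorem speedFloorFrom2_false_of_subfloorStageGAt_of_windowCeilingFrom2 {k : ℕ} (hk : 2 ≤ k)
    (hW : SubfloorStageGAt TowerRates.tuned k) (hC : ∀ j : ℕ, 2 ≤ j → WindowCeilingGAt TowerRates.tuned j) :
    ¬ (∀ j : ℕ, 2 ≤ j → SpeedFloorGAt TowerRates.tuned j) :=
  fun hF => not_speedFloorGAt_of_subfloorStageGAt_of_windowCeilingGAt hW (hC k hk) (hF k hk)

/-- … and, given the ceiling stubs from level `2` on, a sub-floor stage at a tuned level `k ≥ 2` kills `HeredityFromTwoT` VIA the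
speed-floor faces. [folklore] -/
theorem HeredityFromTwoT_false_of_subfloorStageGAt_of_windowCeilingFrom2 {k : ℕ} (hk : 2 ≤ k)
    (hW : SubfloorStageGAt TowerRates.tuned k) (hC : ∀ j : ℕ, 2 ≤ j → WindowCeilingGAt TowerRates.tuned j) :
    ¬ Theses.PalasekTowerBreakdown.HeredityFromTwoT := fun h =>
  speedFloorFrom2_false_of_subfloorStageGAt_of_windowCeilingFrom2 hk hW hC
    fun j hj => ((heredityAtGAt_iff_noPrematureBreakdown_windowCeiling_floors3 j).1 (h.heredityAt hj)).2.2.1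

/-- **A tame speed / strain / core miss at tuned level `1` refutes the crux `HeredityAtOneT`** through the corresponding
floor face (stubs 3 / 4 / 5 of BIRTH-20304 v2). [cite: Sohr2001, Ch. V Thm. 1.5.1] -/
theorem HeredityAtOneT_false_of_tame_speed_miss {S : Schedule TowerRates.tuned} (hP : S.Pins 8 (6 / 5)) (hR : S.Rigid)
    (hQ : S.Quiet) (s : Stage 1 TowerRates.tuned S (Margins.routeG TowerRates.tuned) 1)
    {u : ℝ → EuclideanSpace ℝ (Fin 3) → EuclideanSpace ℝ (Fin 3)} {p : ℝ → EuclideanSpace ℝ (Fin 3) → ℝ}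
    (hcl : IsClassicalNSSolutionOn (Icc 0 (S.τ 2)) 1 S.f u p) (hu0 : u 0 = S.u₀)
    (hE : ∃ C : ℝ≥0∞, C < ⊤ ∧ ∀ t ∈ Icc 0 (S.τ 2), ∫⁻ x, ‖u t x‖ₑ ^ 2 ≤ C)
    (hceil : ∀ t ∈ Icc (S.τ 1) (S.τ 2), ∀ x, ‖u t x‖ ≤ S.c₂ * TowerRates.tuned.Y 2)
    (hmiss : ∀ x, ‖x‖ ≤ S.radius → ‖u (S.τ 2) x‖ < S.c₁ * TowerRates.tuned.Y 2) :
    ¬ Theses.PalasekTowerBreakdown.HeredityAtOneT := fun h =>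
  not_speedFloorGAt_of_tame_miss hP hR hQ s hcl hu0 hE hceil hmiss
    ((heredityAtGAt_iff_noPrematureBreakdown_windowCeiling_floors3 1).1 h).2.2.1

/-- (strain) [cite: Sohr2001, Ch. V Thm. 1.5.1] -/
theorem HeredityAtOneT_false_of_tame_strain_miss {S : Schedule TowerRates.tuned} (hP : S.Pins 8 (6 / 5)) (hR : S.Rigid)
    (hQ : S.Quiet) (s : Stage 1 TowerRates.tuned S (Margins.routeG TowerRates.tuned) 1)
    {u : ℝ → EuclideanSpace ℝ (Fin 3) → EuclideanSpace ℝ (Fin 3)} {p : ℝ → EuclideanSpace ℝ (Fin 3) → ℝ}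
    (hcl : IsClassicalNSSolutionOn (Icc 0 (S.τ 2)) 1 S.f u p) (hu0 : u 0 = S.u₀)
    (hE : ∃ C : ℝ≥0∞, C < ⊤ ∧ ∀ t ∈ Icc 0 (S.τ 2), ∫⁻ x, ‖u t x‖ₑ ^ 2 ≤ C)
    (hceil : ∀ t ∈ Icc (S.τ 1) (S.τ 2), ∀ x, ‖u t x‖ ≤ S.c₂ * TowerRates.tuned.Y 2)
    (hmiss : ∀ x, ‖x‖ ≤ S.radius → ‖fderiv ℝ (u (S.τ 2)) x‖ < S.c₁ * TowerRates.tuned.A 2) :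
    ¬ Theses.PalasekTowerBreakdown.HeredityAtOneT := fun h =>
  not_strainFloorGAt_of_tame_miss hP hR hQ s hcl hu0 hE hceil hmiss
    ((heredityAtGAt_iff_noPrematureBreakdown_windowCeiling_floors3 1).1 h).2.2.2.1

/-- (core circulation) [cite: Sohr2001, Ch. V Thm. 1.5.1] -/
theorem HeredityAtOneT_false_of_tame_core_miss {S : Schedule TowerRates.tuned} (hP : S.Pins 8 (6 / 5)) (hR : S.Rigid)
    (hQ : S.Quiet) (s : Stage 1 TowerRates.tuned S (Margins.routeG TowerRates.tuned) 1)
    {u : ℝ → EuclideanSpace ℝ (Fin 3) → EuclideanSpace ℝ (Fin 3)} {p : ℝ → EuclideanSpace ℝ (Fin 3) → ℝ}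
    (hcl : IsClassicalNSSolutionOn (Icc 0 (S.τ 2)) 1 S.f u p) (hu0 : u 0 = S.u₀)
    (hE : ∃ C : ℝ≥0∞, C < ⊤ ∧ ∀ t ∈ Icc 0 (S.τ 2), ∫⁻ x, ‖u t x‖ₑ ^ 2 ≤ C)
    (hceil : ∀ t ∈ Icc (S.τ 1) (S.τ 2), ∀ x, ‖u t x‖ ≤ S.c₂ * TowerRates.tuned.Y 2)
    (hmiss : ∀ (x : EuclideanSpace ℝ (Fin 3)) (γ : ℝ → EuclideanSpace ℝ (Fin 3)), ‖x‖ ≤ S.radius →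
      ContDiff ℝ 1 γ → γ 0 = γ 1 → (∀ σ ∈ Icc (0 : ℝ) 1, γ σ ∈ Metric.closedBall x (1 / TowerRates.tuned.N 2)) →
      (∀ σ ∈ Icc (0 : ℝ) 1, ‖deriv γ σ‖ ≤ 8 * Real.pi / TowerRates.tuned.N 2) →
      circulation (u (S.τ 2)) γ < S.c₁ * TowerRates.tuned.N 2 ^ (TowerRates.tuned.β - 2)) :
    ¬ Theses.PalasekTowerBreakdown.HeredityAtOneT := fun h =>
  not_coreFloorGAt_of_tame_miss hP hR hQ s hcl hu0 hE hceil hmiss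
    ((heredityAtGAt_iff_noPrematureBreakdown_windowCeiling_floors3 1).1 h).2.2.2.2

end Summit.NavierStokesRegularity.HeredityAtOneTSubfloor
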